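import Summits.ValiantsHypothesis.ValiantsHypothesis.Theorems.BarrierLeverPartitionMinorsChowTwoEdgeCoreEngine

/-!
# Route BarrierLever — Chow witnesses for partition minors (item 20172, CPM): the STRUCTURE OF A
# MINIMAL MISSED LAYOUT after all the seat's reductions (contrapositive of the engine with all steps)

Helper file (`--supports stmt-ValiantsHypothesis-20172`; cell valiant-natproofs, rung V4, 𝒟-side of
door (c); seat val-np-p4 gen 13).  Closes NO item.

`exists_twoEdgeCore_of_not_hit` — if some injective layout is missed by every product of `h + h`
affine forms, then some injective layout `(u, w)` is missed which is LOCKED (no row literal class has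
the size of a column literal class), UNPEELABLE at every coordinate pair, of size `r ≥ h + 1`, admits
NO LEAF STEP (rows or columns), NO EDGE STEP (a row coordinate and a column coordinate each with
exactly one edge), NO DOUBLE STEP (rows or columns: a star-like pair of coordinates against a double
collision with nonsingular status-difference matrix) and NO TWO-EDGE STEP (a row coordinate and a
column coordinate each with exactly two edges).  This is the census filter of record for minimal
counterexample candidates (memo HOME/val-np-p4/g13 §3–§4; kit j281461 / j282264 / j283701 / j284074).

WHAT THIS IS NOT: a structure theorem, not a hit; nothing on items 20172 / 20195 / 19717 themselves,
on crux stmt-ValiantsHypothesis-14610, or on `VP` versus `VNP`.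
-/

set_option linter.dupNamespace false

namespace Summit.ValiantsHypothesis.ValiantsHypothesis.Theorems.BarrierLever.ChowFactor

open Finset MvPolynomial

noncomputable section

/-- **Structure of a minimal missed layout, after all reductions of the seat.** -/
theorem exists_twoEdgeCore_of_not_hit {h₀ r₀ : ℕ} (u₀ w₀ : Fin r₀ → Finset (Fin h₀))
    (hu₀ : Function.Injective u₀) (hw₀ : Function.Injective w₀)
    (hnot : ¬ ∃ ℓ : Fin (h₀ + h₀) → MvPolynomial (Fin (h₀ + h₀)) ℂ, (∀ q, (ℓ q).totalDegree ≤ 1) ∧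
      (Matrix.of fun i j : Fin r₀ => coeff
        (∑ b ∈ u₀ i, Finsupp.single (Fin.castAdd h₀ b) 1 + ∑ d ∈ w₀ j, Finsupp.single (Fin.natAdd h₀ d) 1)
        (∏ q, ℓ q)).det ≠ 0) :
    ∃ (h r : ℕ) (u w : Fin r → Finset (Fin h)), Function.Injective u ∧ Function.Injective w ∧
      (∀ (a c : Fin h) (β γ : Bool),
        (Finset.univ.filter fun i => (a ∈ u i ↔ β = true)).card ≠
          (Finset.univ.filter fun j => (c ∈ w j ↔ γ = true)).card) ∧
      (∀ a c : Fin h, ¬ (Function.Injective (fun i => (u i).erase a) ∧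
        Function.Injective (fun j => (w j).erase c))) ∧
      (h + 1 ≤ r) ∧
      (∀ (a c : Fin h) (i₁ j₁ j₀ : Fin r), (∀ i, i ≠ i₁ → (a ∈ u i ↔ a ∉ u i₁)) → j₁ ≠ j₀ →
        w j₀ = (w j₁).erase c → ¬ Set.InjOn (fun j => (w j).erase c) {j | j ≠ j₁}) ∧
      (∀ (c a : Fin h) (j₁ i₁ i₀ : Fin r), (∀ j, j ≠ j₁ → (c ∈ w j ↔ c ∉ w j₁)) → i₁ ≠ i₀ →
        u i₀ = (u i₁).erase a → ¬ Set.InjOn (fun i => (u i).erase a) {i | i ≠ i₁}) ∧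
      (∀ (a c : Fin h) (i₁ i₀ j₁ j₀ : Fin r), i₁ ≠ i₀ → u i₀ = (u i₁).erase a → j₁ ≠ j₀ →
        w j₀ = (w j₁).erase c → ¬ (Set.InjOn (fun i => (u i).erase a) {i | i ≠ i₁} ∧
          Set.InjOn (fun j => (w j).erase c) {j | j ≠ j₁})) ∧
      (∀ (a a' c c' : Fin h) (i₀ v₁ v₂ j₀ j₀' j₁ j₂ : Fin r), a' ≠ a → c' ≠ c → v₁ ≠ i₀ → v₂ ≠ i₀ →
        v₂ ≠ v₁ → (a ∈ u v₁ ↔ a ∉ u i₀) → (a' ∈ u v₁ ↔ a' ∈ u i₀) → (a ∈ u v₂ ↔ a ∈ u i₀) →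
        (a' ∈ u v₂ ↔ a' ∉ u i₀) → ((u v₁).erase a).erase a' = ((u i₀).erase a).erase a' →
        ((u v₂).erase a).erase a' = ((u i₀).erase a).erase a' →
        j₀ ≠ j₁ → j₀' ≠ j₁ → j₀' ≠ j₂ → j₂ ≠ j₁ →
        ((w j₁).erase c).erase c' = ((w j₀).erase c).erase c' →
        ((w j₂).erase c).erase c' = ((w j₀').erase c).erase c' →
        ((if c ∈ w j₁ then (1 : ℂ) else 0) - (if c ∈ w j₀ then 1 else 0)) *
            ((if c' ∈ w j₂ then (1 : ℂ) else 0) - (if c' ∈ w j₀' then 1 else 0)) ≠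
          ((if c ∈ w j₂ then (1 : ℂ) else 0) - (if c ∈ w j₀' then 1 else 0)) *
            ((if c' ∈ w j₁ then (1 : ℂ) else 0) - (if c' ∈ w j₀ then 1 else 0)) →
        ¬ (Set.InjOn (fun i => ((u i).erase a).erase a') {i | i ≠ v₁ ∧ i ≠ v₂} ∧
          Set.InjOn (fun j => ((w j).erase c).erase c') {j | j ≠ j₁ ∧ j ≠ j₂})) ∧
      (∀ (c c' a a' : Fin h) (j₀ v₁ v₂ i₀ i₀' i₁ i₂ : Fin r), c' ≠ c → a' ≠ a → v₁ ≠ j₀ → v₂ ≠ j₀ →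
        v₂ ≠ v₁ → (c ∈ w v₁ ↔ c ∉ w j₀) → (c' ∈ w v₁ ↔ c' ∈ w j₀) → (c ∈ w v₂ ↔ c ∈ w j₀) →
        (c' ∈ w v₂ ↔ c' ∉ w j₀) → ((w v₁).erase c).erase c' = ((w j₀).erase c).erase c' →
        ((w v₂).erase c).erase c' = ((w j₀).erase c).erase c' →
        i₀ ≠ i₁ → i₀' ≠ i₁ → i₀' ≠ i₂ → i₂ ≠ i₁ →
        ((u i₁).erase a).erase a' = ((u i₀).erase a).erase a' →
        ((u i₂).erase a).erase a' = ((u i₀').erase a).erase a' →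
        ((if a ∈ u i₁ then (1 : ℂ) else 0) - (if a ∈ u i₀ then 1 else 0)) *
            ((if a' ∈ u i₂ then (1 : ℂ) else 0) - (if a' ∈ u i₀' then 1 else 0)) ≠
          ((if a ∈ u i₂ then (1 : ℂ) else 0) - (if a ∈ u i₀' then 1 else 0)) *
            ((if a' ∈ u i₁ then (1 : ℂ) else 0) - (if a' ∈ u i₀ then 1 else 0)) →
        ¬ (Set.InjOn (fun j => ((w j).erase c).erase c') {j | j ≠ v₁ ∧ j ≠ v₂} ∧
          Set.InjOn (fun i => ((u i).erase a).erase a') {i | i ≠ i₁ ∧ i ≠ i₂})) ∧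
      (∀ (a c : Fin h) (v₀ v₀' v₁ v₂ j₀ j₀' j₁ j₂ : Fin r), v₂ ≠ v₁ → a ∈ u v₁ → a ∈ u v₂ →
        u v₀ = (u v₁).erase a → u v₀' = (u v₂).erase a → j₂ ≠ j₁ → j₀ ≠ j₁ → j₀' ≠ j₁ → j₀' ≠ j₂ →
        c ∈ w j₁ → c ∈ w j₂ → w j₀ = (w j₁).erase c → w j₀' = (w j₂).erase c →
        ¬ (Set.InjOn (fun i => (u i).erase a) {i | i ≠ v₁ ∧ i ≠ v₂} ∧
          Set.InjOn (fun j => (w j).erase c) {j | j ≠ j₁ ∧ j ≠ j₂})) ∧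
      ¬ ∃ ℓ : Fin (h + h) → MvPolynomial (Fin (h + h)) ℂ, (∀ q, (ℓ q).totalDegree ≤ 1) ∧
        (Matrix.of fun i j : Fin r => coeff
          (∑ b ∈ u i, Finsupp.single (Fin.castAdd h b) 1 + ∑ d ∈ w j, Finsupp.single (Fin.natAdd h d) 1)
          (∏ q, ℓ q)).det ≠ 0 := by
  by_contra hall
  push Not at hall
  refine hnot (chow_hit_of_twoEdgeCore ?_ h₀ r₀ u₀ w₀ hu₀ hw₀)
  intro h r u w hu hw hlk hpl hsz hrow hcol hedge hd hd' hte
  exact hall h r u w hu hw hlk (fun a c h1 h2 => hpl a c ⟨h1, h2⟩) hsz hrow hcol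
    (fun a c i₁ i₀ j₁ j₀ hi hi₀ hj hj₀ h1 h2 => hedge a c i₁ i₀ j₁ j₀ hi hi₀ hj hj₀ ⟨h1, h2⟩)
    (fun a a' c c' i₀ v₁ v₂ j₀ j₀' j₁ j₂ h1 h2 h3 h4 h5 h6 h7 h8 h9 h10 h11 h12 h13 h14 h15 h16 h17 h18 h19
        h20 => hd a a' c c' i₀ v₁ v₂ j₀ j₀' j₁ j₂ h1 h2 h3 h4 h5 h6 h7 h8 h9 h10 h11 h12 h13 h14 h15 h16
        h17 h18 ⟨h19, h20⟩)
    (fun c c' a a' j₀ v₁ v₂ i₀ i₀' i₁ i₂ h1 h2 h3 h4 h5 h6 h7 h8 h9 h10 h11 h12 h13 h14 h15 h16 h17 h18 h19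
        h20 => hd' c c' a a' j₀ v₁ v₂ i₀ i₀' i₁ i₂ h1 h2 h3 h4 h5 h6 h7 h8 h9 h10 h11 h12 h13 h14 h15
        h16 h17 h18 ⟨h19, h20⟩)
    (fun a c v₀ v₀' v₁ v₂ j₀ j₀' j₁ j₂ h1 h2 h3 h4 h5 h6 h7 h8 h9 h10 h11 h12 h13 h14 h15 =>
      hte a c v₀ v₀' v₁ v₂ j₀ j₀' j₁ j₂ h1 h2 h3 h4 h5 h6 h7 h8 h9 h10 h11 h12 h13 ⟨h14, h15⟩)

end

end Summit.ValiantsHypothesis.ValiantsHypothesis.Theorems.BarrierLever.ChowFactor
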